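import Literature.AlgebraicGeometry.Frobenioids.ArchimedeanBaseEquivalence
import Literature.AlgebraicGeometry.Frobenioids.ArchimedeanCharSplitting
import Literature.AlgebraicGeometry.Frobenioids.ArchimedeanDivisorMaximality
import Literature.AlgebraicGeometry.Frobenioids.ArchimedeanFSMProofs
import Literature.AlgebraicGeometry.Frobenioids.ArchimedeanFSMRepairedClosed
import Literature.AlgebraicGeometry.Frobenioids.ArchimedeanIsometrizationEquivalence
import Literature.AlgebraicGeometry.Frobenioids.ArchimedeanUnitTopology
import Literature.AlgebraicGeometry.Frobenioids.ArchimedeanUnitTopologyAngular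
import Literature.AlgebraicGeometry.Frobenioids.FiniteEtaleBaseProofs
import Literature.AlgebraicGeometry.Frobenioids.GroupLikeStandardExampleProofs
import Literature.AlgebraicGeometry.Frobenioids.IrreducibleMorphismsChainsConverse
import Literature.AlgebraicGeometry.Frobenioids.MotivatingExamplesSubHoldsB
import Literature.AlgebraicGeometry.Frobenioids.MotivatingExamplesSubProofs
import Literature.AlgebraicGeometry.Frobenioids.MotivatingExamplesSubSplitPrimes
import Literature.AlgebraicGeometry.Frobenioids.NaiveFrobeniusFunctorProofs
import Literature.AlgebraicGeometry.Frobenioids.NumberFieldLocalizationApplication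
import Literature.AlgebraicGeometry.Frobenioids.NumberFieldLocalizationCategoriesFSMFF
import Literature.AlgebraicGeometry.Frobenioids.NumberFieldLocalizationCategoriesProofs
import Literature.AlgebraicGeometry.Frobenioids.OneObjectAutForget
import Literature.AlgebraicGeometry.Frobenioids.PadicFrobenioidRmk122
import Literature.AlgebraicGeometry.Frobenioids.PadicFrobenioidThm12Proofs
import Literature.AlgebraicGeometry.Frobenioids.PadicFrobenioidTwistProofs
import Literature.AlgebraicGeometry.Frobenioids.PadicFrobenioidTwistSplitting
import Literature.AlgebraicGeometry.Frobenioids.PadicFrobenioidTwistUnique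
import Literature.AlgebraicGeometry.Frobenioids.PadicFrobenioidUnitSplittings
import Literature.AlgebraicGeometry.Frobenioids.PadicUnitGroupProfinite

/-!
# Exact-name kernel witnesses `<Decl>_holds` for [FrdI]/[FrdII] named facts (FACT-LIST block «Frobenioids · outside/unplaced»)

abc-iut cell, D-0067 FACT-LIST (plan/FACT-LIST.md v3, owner abc-iut-dag), rule R7 (2026-08-25T23:49:42Z):
a named-fact row `def <Decl> … : Prop` counts as **proved** — and stops being an admissible ASSUMPTION of
the [IUTchIII] Cor 3.12 adjudication — only if the tree carries a theorem named exactly `<Decl>_holds`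
whose type is the universal closure of the def.  The 40 facts below already HAVE unconditional kernel
proofs in the tree, filed by the L1 typer/prover seats under lowerCamel or suffix-free names
(`thm12_ii_holds`, `rmk361_C`, …); this PROOF-ONLY file re-exports each under the exact name with the
FULLY-QUALIFIED closed type (all data / instance binders universally quantified), so that the row
flips by the mechanical rule and a reader can audit the claim with one `#print axioms`.  Every
right-hand side is a term of the tree: nothing is restated, no definition is touched, no hypothesis
is added or removed.  Where the exact lowerCamel name already exists with a short type
(`Ex63_isFrobenioid_holds`, `Thm64iv_L04_degreeEq_holds`) the closed FQ form is given a prime.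
Companion table: `HOME/staging/w5/w5-d112/FACT-LIST-L1out-witnesses-w5d112.tsv` (its rows F-1109 /
F-0803 are covered by the landed lowerCamel witnesses `PreFrobenioid.nonPreStepIffBoundedFSMIChains2024_holds` /
`ArchFrd.C0.isConnectedStatement_holds`, which the gate's dedup identifies with the exact-name form).

typed ≠ proved for everything NOT in this file; nothing here bears on the truth of [IUTchIII] Cor 3.12.

## References
* [MochizukiFrdI2008] S. Mochizuki, *The geometry of Frobenioids I: the general theory*, Kyushu J.
  Math. 62 (2008) — Prop 1.14 (iii), Rmk 2.1.1, Ex 3.6/3.8/3.9, Ex 4.7 (ii), §6 (Ex 6.1/6.3, Thm 6.4).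
* [MochizukiFrdII2008] S. Mochizuki, *The geometry of Frobenioids II: poly-Frobenioids*, Kyushu J.
  Math. 62 (2008) — Ex 1.1, Thm 1.2, Rmk 1.2.2, Ex 1.4, Prop 1.5, §3 (Def 3.1, Ex 3.3, Prop 3.4, Thm 3.6, Rmk 3.6.1).
-/

namespace Literature.AlgebraicGeometry.Frobenioids

universe w v v' u u'

/-- FACT-LIST F-0720: [FrdII] Ex 1.4: the category 𝒫 attached to (G, D) is totally epimorphic; exact-name CLOSED witness (proof = `NFLocCat.pTotallyEpimorphic_holds`,
NumberFieldLocalizationCategoriesProofs.lean). [cite: MochizukiFrdII2008, Ex. 1.4 (ii) p.13] -/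
theorem NFLocCat.PTotallyEpimorphic_holds :
    ∀ {G : Type u} [Group G] [TopologicalSpace G] (D : Subgroup G) [IsTopologicalGroup G], Literature.AlgebraicGeometry.Frobenioids.NFLocCat.PTotallyEpimorphic G D :=
  fun D _ => NFLocCat.pTotallyEpimorphic_holds D

/-- FACT-LIST F-0721: [FrdII] Rmk 1.2.2, clause (R2), for every p-adic Frobenioid datum; exact-name CLOSED witness (proof = `d.rmk122R2_holds`,
PadicFrobenioidUnitSplittings.lean). [cite: MochizukiFrdII2008, Remark 1.2.2 p.10] -/
theorem PadicFrd.Datum.Rmk122R2_holds :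
    ∀ {D : Type u} [CategoryTheory.Category.{v} D] {p : ℕ} [Fact p.Prime] (d : PadicFrd.Datum D p), Literature.AlgebraicGeometry.Frobenioids.PadicFrd.Datum.Rmk122R2 d :=
  fun d => d.rmk122R2_holds

/-- FACT-LIST F-0722: [FrdII] Rmk 1.2.2, self-equivalence clause; exact-name CLOSED witness (proof = `d.rmk122SelfEquivalence_holds`,
PadicFrobenioidRmk122.lean). [cite: MochizukiFrdII2008, Remark 1.2.2 p.10] -/
theorem PadicFrd.Datum.Rmk122SelfEquivalence_holds :
    ∀ {D : Type u} [CategoryTheory.Category.{v} D] {p : ℕ} [Fact p.Prime] (d : PadicFrd.Datum D p), Literature.AlgebraicGeometry.Frobenioids.PadicFrd.Datum.Rmk122SelfEquivalence d :=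
  fun d => d.rmk122SelfEquivalence_holds

/-- FACT-LIST F-0723: [FrdII] Rmk 1.2.2, twist-of-bijective clause; exact-name CLOSED witness (proof = `d.rmk122TwistOfBijective_holds`,
PadicFrobenioidTwistSplitting.lean). [cite: MochizukiFrdII2008, Remark 1.2.2 p.10] -/
theorem PadicFrd.Datum.Rmk122TwistOfBijective_holds :
    ∀ {D : Type u} [CategoryTheory.Category.{v} D] {p : ℕ} [Fact p.Prime] (d : PadicFrd.Datum D p), Literature.AlgebraicGeometry.Frobenioids.PadicFrd.Datum.Rmk122TwistOfBijective d :=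
  fun d => d.rmk122TwistOfBijective_holds

/-- FACT-LIST F-1185: [FrdII] Rmk 1.2.2, uniqueness clause; exact-name CLOSED witness (proof = `d.rmk122UOfBijective_holds`,
PadicFrobenioidTwistUnique.lean). [cite: MochizukiFrdII2008, Remark 1.2.2 p.10] -/
theorem PadicFrd.Datum.Rmk122UOfBijective_holds :
    ∀ {D : Type u} [CategoryTheory.Category.{v} D] {p : ℕ} [Fact p.Prime] (d : PadicFrd.Datum D p), Literature.AlgebraicGeometry.Frobenioids.PadicFrd.Datum.Rmk122UOfBijective d :=
  fun d => d.rmk122UOfBijective_holds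

/-- FACT-LIST F-1186: [FrdII] Rmk 1.2.2, twist; exact-name CLOSED witness (proof = `PadicFrd.Datum.rmk122_twist_holds`,
PadicFrobenioidTwistProofs.lean). [cite: MochizukiFrdII2008, Remark 1.2.2 p.10] -/
theorem PadicFrd.Rmk122_twist_holds :
    ∀ {D : Type u} [CategoryTheory.Category.{v} D] {p : ℕ} [Fact p.Prime] (d : PadicFrd.Datum D p), Literature.AlgebraicGeometry.Frobenioids.PadicFrd.Rmk122_twist d :=
  fun d => PadicFrd.Datum.rmk122_twist_holds d

/-- FACT-LIST F-0726: [FrdII] Thm 1.2 (i), unit-group clause (topologically finitely generated profinite units); exact-name CLOSED witness (proof = `PadicFrd.Datum.thm12_i_unitProfinite`,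
PadicUnitGroupProfinite.lean). [cite: MochizukiFrdII2008, Theorem 1.2 (i) p.9] -/
theorem PadicFrd.Thm12_i_unitProfinite_holds :
    ∀ {D : Type u} [CategoryTheory.Category.{v} D] {p : ℕ} [Fact p.Prime] (d : PadicFrd.Datum D p), Literature.AlgebraicGeometry.Frobenioids.PadicFrd.Thm12_i_unitProfinite d :=
  fun d => PadicFrd.Datum.thm12_i_unitProfinite d

/-- FACT-LIST F-1189: [FrdII] Thm 1.2 (ii); exact-name CLOSED witness (proof = `PadicFrd.Datum.thm12_ii_holds`,
PadicFrobenioidThm12Proofs.lean). [cite: MochizukiFrdII2008, Theorem 1.2 (ii) p.9] -/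
theorem PadicFrd.Thm12_ii_holds :
    ∀ {D : Type u} [CategoryTheory.Category.{v} D] {p : ℕ} [Fact p.Prime] (d : PadicFrd.Datum D p), Literature.AlgebraicGeometry.Frobenioids.PadicFrd.Thm12_ii d :=
  fun d => PadicFrd.Datum.thm12_ii_holds d

/-- FACT-LIST F-1190: [FrdII] Thm 1.2 (iii); exact-name CLOSED witness (proof = `PadicFrd.Datum.thm12_iii_holds`,
PadicFrobenioidThm12Proofs.lean). [cite: MochizukiFrdII2008, Theorem 1.2 (iii) p.9] -/
theorem PadicFrd.Thm12_iii_holds :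
    ∀ {D : Type u} [CategoryTheory.Category.{v} D] {p : ℕ} [Fact p.Prime] (d : PadicFrd.Datum D p), Literature.AlgebraicGeometry.Frobenioids.PadicFrd.Thm12_iii d :=
  fun d => PadicFrd.Datum.thm12_iii_holds d

/-- FACT-LIST F-0778: [FrdII] §3: the comparison functor from the tree's archimedean base `D0` to `ArchBase` is an equivalence; exact-name CLOSED witness (proof = `ArchFrd.D0.toArchBaseIsEquivalence_holds`,
ArchimedeanBaseEquivalence.lean). [cite: MochizukiFrdII2008, Definition 3.1 p.23] -/
theorem ArchFrd.D0.ToArchBaseIsEquivalence_holds :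
    Literature.AlgebraicGeometry.Frobenioids.ArchFrd.D0.ToArchBaseIsEquivalence :=
  ArchFrd.D0.toArchBaseIsEquivalence_holds

/-- FACT-LIST F-0802: [FrdII] Ex 3.3 (i), maximality of Div; exact-name CLOSED witness (proof = `ArchFrd.C0.divIsLogLargest_holds`,
ArchimedeanDivisorMaximality.lean). [cite: MochizukiFrdII2008, Example 3.3 (i) p.28] -/
theorem ArchFrd.C0.DivIsLogLargest_holds :
    Literature.AlgebraicGeometry.Frobenioids.ArchFrd.C0.DivIsLogLargest :=
  ArchFrd.C0.divIsLogLargest_holds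

/-- FACT-LIST F-0807: [FrdII] Prop 3.4 (i) for the towers 𝒜/𝒩/ℛ over every base; exact-name CLOSED witness (proof = `ArchFrd.prop34_i_holds`,
ArchimedeanFSMProofs.lean). [cite: MochizukiFrdII2008, Proposition 3.4 (i) p.29] -/
theorem ArchFrd.Prop34_i_holds :
    ∀ {D : Type u} [CategoryTheory.Category.{v} D] (π : CategoryTheory.Functor D ArchFrd.D0), Literature.AlgebraicGeometry.Frobenioids.ArchFrd.Prop34_i π :=
  fun π => ArchFrd.prop34_i_holds π

/-- FACT-LIST F-0826: [FrdII] Prop 3.4 (iii), complex-regime-guarded form (plan R5 replacement of F-0809); exact-name CLOSED witness (proof = `ArchFrd.prop34_iiiR_holds`,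
ArchimedeanFSMRepairedClosed.lean). [cite: MochizukiFrdII2008, Proposition 3.4 (iii) p.30] -/
theorem ArchFrd.Prop34_iiiR_holds :
    ∀ {D : Type u} [CategoryTheory.Category.{v} D] (π : CategoryTheory.Functor D ArchFrd.D0), Literature.AlgebraicGeometry.Frobenioids.ArchFrd.Prop34_iiiR π :=
  fun π => ArchFrd.prop34_iiiR_holds π

/-- FACT-LIST F-0827: [FrdII] Prop 3.4 (vi), complex-regime-guarded form; exact-name CLOSED witness (proof = `ArchFrd.prop34_viR_holds`,
ArchimedeanFSMRepairedClosed.lean). [cite: MochizukiFrdII2008, Proposition 3.4 (vi) p.30] -/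
theorem ArchFrd.Prop34_viR_holds :
    ∀ {D : Type u} [CategoryTheory.Category.{v} D] (π : CategoryTheory.Functor D ArchFrd.D0), Literature.AlgebraicGeometry.Frobenioids.ArchFrd.Prop34_viR π :=
  fun π => ArchFrd.prop34_viR_holds π

/-- FACT-LIST F-0856: [FrdII] Thm 3.6 (iii), the isometrization functor of 𝒞 is an equivalence; exact-name CLOSED witness (proof = `ArchFrd.thm36iii_equivalence_C`,
ArchimedeanIsometrizationEquivalence.lean). [cite: MochizukiFrdII2008, Theorem 3.6 (iii) p.37] -/
theorem ArchFrd.Thm36iii_equivalence_C_holds :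
    ∀ {D : Type u} [CategoryTheory.Category.{v} D] (π : CategoryTheory.Functor D ArchFrd.D0), Literature.AlgebraicGeometry.Frobenioids.ArchFrd.Thm36iii_equivalence_C π :=
  fun π => ArchFrd.thm36iii_equivalence_C π

/-- FACT-LIST F-0867: [FrdII] Rmk 3.6.1 for 𝒞 (unit topology); exact-name CLOSED witness (proof = `ArchFrd.rmk361_C`,
ArchimedeanUnitTopology.lean). [cite: MochizukiFrdII2008, Remark 3.6.1 p.39] -/
theorem ArchFrd.Rmk361_C_holds :
    ∀ {D : Type u} [CategoryTheory.Category.{v} D] (π : CategoryTheory.Functor D ArchFrd.D0), Literature.AlgebraicGeometry.Frobenioids.ArchFrd.Rmk361_C π :=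
  fun π => ArchFrd.rmk361_C π

/-- FACT-LIST F-2635: [FrdII] Thm 3.6 (i), characteristic splitting for 𝒞; exact-name CLOSED witness (proof = `ArchFrd.thm36i_charSplitting_C`,
ArchimedeanCharSplitting.lean). [cite: MochizukiFrdII2008, Theorem 3.6 (i) p.36] -/
theorem ArchFrd.Thm36i_charSplitting_C_holds :
    ∀ {D : Type u} [CategoryTheory.Category.{v} D] (π : CategoryTheory.Functor D ArchFrd.D0), Literature.AlgebraicGeometry.Frobenioids.ArchFrd.Thm36i_charSplitting_C π :=
  fun π => ArchFrd.thm36i_charSplitting_C π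

/-- FACT-LIST F-2636: [FrdII] Rmk 3.6.1 for the angular Frobenioid 𝒜; exact-name CLOSED witness (proof = `ArchFrd.rmk361_A`,
ArchimedeanUnitTopologyAngular.lean). [cite: MochizukiFrdII2008, Remark 3.6.1 p.39] -/
theorem ArchFrd.Rmk361_A_holds :
    ∀ {D : Type u} [CategoryTheory.Category.{v} D] (π : CategoryTheory.Functor D ArchFrd.D0), Literature.AlgebraicGeometry.Frobenioids.ArchFrd.Rmk361_A π :=
  fun π => ArchFrd.rmk361_A π

/-- FACT-LIST F-1022: [FrdI] Ex 4.7 (ii): Aut of the forgetful functor of the one-object base recovers G; exact-name CLOSED witness (proof = `Ex47ii.autForgetIsoG_holds`,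
OneObjectAutForget.lean). [cite: MochizukiFrdI2008, Example 4.7 (ii) p.87] -/
theorem Ex47ii.AutForgetIsoG_holds :
    Literature.AlgebraicGeometry.Frobenioids.Ex47ii.AutForgetIsoG :=
  Ex47ii.autForgetIsoG_holds

/-- FACT-LIST F-1163: [FrdI] Ex 3.9 (non-preservation of units), base-group recovery; exact-name CLOSED witness (proof = `Ex39.autForgetIsoG_holds`,
OneObjectAutForget.lean). [cite: MochizukiFrdI2008, Example 3.9 p.72] -/
theorem Ex39.AutForgetIsoG_holds :
    Literature.AlgebraicGeometry.Frobenioids.Ex39.AutForgetIsoG :=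
  Ex39.autForgetIsoG_holds

/-- FACT-LIST F-1210: [FrdI] Ex 3.8 (permutation of primes), base-group recovery; exact-name CLOSED witness (proof = `Ex38.autForgetIsoG_holds`,
OneObjectAutForget.lean). [cite: MochizukiFrdI2008, Example 3.8 p.71] -/
theorem Ex38.AutForgetIsoG_holds :
    Literature.AlgebraicGeometry.Frobenioids.Ex38.AutForgetIsoG :=
  Ex38.autForgetIsoG_holds

/-- FACT-LIST F-1085: [FrdII] §3: the archimedean base category is of FSM-type; exact-name CLOSED witness (proof = `ArchBase.isOfFSMTypeFact_holds`,
FiniteEtaleBaseProofs.lean). [cite: MochizukiFrdII2008, Definition 3.1 p.23] -/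
theorem ArchBase.IsOfFSMTypeFact_holds :
    Literature.AlgebraicGeometry.Frobenioids.ArchBase.IsOfFSMTypeFact :=
  ArchBase.isOfFSMTypeFact_holds

/-- FACT-LIST F-1091: [FrdII] §1: the p-adic base category is of FSM-type, for every prime p; exact-name CLOSED witness (proof = `PadicBase.isOfFSMTypeFact_holds`,
FiniteEtaleBaseProofs.lean). [cite: MochizukiFrdII2008, Example 1.1 p.7] -/
theorem PadicBase.IsOfFSMTypeFact_holds :
    ∀ (p : ℕ) [Fact p.Prime], Literature.AlgebraicGeometry.Frobenioids.PadicBase.IsOfFSMTypeFact p :=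
  fun p _ => PadicBase.isOfFSMTypeFact_holds p

/-- FACT-LIST F-1106: [FrdI] Ex 3.6: the base of the group-like standard example is slim; exact-name CLOSED witness (proof = `Ex36.dSlim_holds`,
GroupLikeStandardExampleProofs.lean). [cite: MochizukiFrdI2008, Example 3.6 p.70] -/
theorem Ex36.DSlim_holds :
    Literature.AlgebraicGeometry.Frobenioids.Ex36.DSlim :=
  Ex36.dSlim_holds

/-- FACT-LIST F-1107: [FrdI] Ex 3.6: irreducible ⟺ prime in the standard example; exact-name CLOSED witness (proof = `Ex36.irreducibleIffPrime_holds`,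
GroupLikeStandardExampleProofs.lean). [cite: MochizukiFrdI2008, Example 3.6 p.70] -/
theorem Ex36.IrreducibleIffPrime_holds :
    Literature.AlgebraicGeometry.Frobenioids.Ex36.IrreducibleIffPrime :=
  Ex36.irreducibleIffPrime_holds

/-- FACT-LIST F-1108: [FrdI] Prop 1.14 (iii), FSMI-restricted form (the 2008 universal form F-0717 is kernel-refuted; this and the 2024 form are the repaired rows); exact-name CLOSED witness (proof = `PreFrobenioid.nonPreStepIffBoundedFSMIChainsOfFSMI_holds`,
IrreducibleMorphismsChainsConverse.lean). [cite: MochizukiFrdI2008, Proposition 1.14 (iii) p.43] -/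
theorem PreFrobenioid.NonPreStepIffBoundedFSMIChainsOfFSMI_holds :
    Literature.AlgebraicGeometry.Frobenioids.PreFrobenioid.NonPreStepIffBoundedFSMIChainsOfFSMI.{w, v, v', u, u'} :=
  PreFrobenioid.nonPreStepIffBoundedFSMIChainsOfFSMI_holds

/-- FACT-LIST F-1130: [FrdI] Ex 6.3 / Thm 5.2: the arithmetic Frobenioid of a Galois extension K/F of a number field is a Frobenioid; exact-name CLOSED witness (proof = `Ex63_isFrobenioid_holds`,
MotivatingExamplesSubHoldsB.lean). [cite: MochizukiFrdI2008, Example 6.3 p.115] -/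
theorem Ex63_isFrobenioid_holds' :
    ∀ (F : Type) [Field F] [NumberField F] (K : Type) [Field K] [Algebra F K] [IsGalois F K], Literature.AlgebraicGeometry.Frobenioids.Ex63_isFrobenioid F K :=
  fun F _ _ K _ _ _ => Ex63_isFrobenioid_holds F K

/-- FACT-LIST F-1131: [FrdI] §6: permutation scalings are trivial; exact-name CLOSED witness (proof = `permScalingTrivial_holds`,
MotivatingExamplesSubProofs.lean). [cite: MochizukiFrdI2008, Example 6.1 p.112] -/
theorem PermScalingTrivial_holds :
    Literature.AlgebraicGeometry.Frobenioids.PermScalingTrivial :=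
  permScalingTrivial_holds

/-- FACT-LIST F-1156: [FrdI] Thm 6.4 sub-lemma L04 (degree equality); exact-name CLOSED witness (proof = `Thm64iv_L04_degreeEq_holds`,
MotivatingExamplesSubSplitPrimes.lean). [cite: MochizukiFrdI2008, Theorem 6.4 (iii) p.116] -/
theorem Thm64iv_L04_degreeEq_holds' :
    Literature.AlgebraicGeometry.Frobenioids.Thm64iv_L04_degreeEq :=
  Thm64iv_L04_degreeEq_holds

/-- FACT-LIST F-1162: [FrdI] Rmk 2.1.1: the naive Frobenius functor is independent of the rational exponent representation; exact-name CLOSED witness (proof = `PreFrobenioid.naiveFrobeniusRatIndependent_holds`,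
NaiveFrobeniusFunctorProofs.lean). [cite: MochizukiFrdI2008, Remark 2.1.1 p.45] -/
theorem PreFrobenioid.NaiveFrobeniusRatIndependent_holds :
    ∀ {D : Type u} [CategoryTheory.Category.{v} D] {Φ : CategoryTheory.Functor Dᵒᵖ CommMonCat.{w}} {C : Type u'} [CategoryTheory.Category.{v'} C] {F : CategoryTheory.Functor C (ElemFrobenioid Φ)}, Literature.AlgebraicGeometry.Frobenioids.PreFrobenioid.NaiveFrobeniusRatIndependent F :=
  fun {_} _ {_} {_} _ {_} => PreFrobenioid.naiveFrobeniusRatIndependent_holds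

/-- FACT-LIST F-1165: [FrdII] Ex 1.4 (iii), author-repaired form; exact-name CLOSED witness (proof = `NFLocCat.applicationToPadicFrobenioidsRepaired_holds`,
NumberFieldLocalizationApplication.lean). [cite: MochizukiFrdII2008, Example 1.4 (iii) p.14] -/
theorem NFLocCat.ApplicationToPadicFrobenioidsRepaired_holds :
    ∀ {G : Type u} [Group G] [TopologicalSpace G] (D : Subgroup G), Literature.AlgebraicGeometry.Frobenioids.NFLocCat.ApplicationToPadicFrobenioidsRepaired G D :=
  fun D => NFLocCat.applicationToPadicFrobenioidsRepaired_holds D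

/-- FACT-LIST F-1167: [FrdII] Ex 1.4 (ii): ℰ is connected; exact-name CLOSED witness (proof = `NFLocCat.eConnected_holds`,
NumberFieldLocalizationCategoriesProofs.lean). [cite: MochizukiFrdII2008, Example 1.4 (ii) p.13] -/
theorem NFLocCat.EConnected_holds :
    ∀ {G : Type u} [Group G] [TopologicalSpace G] (D : Subgroup G) [IsTopologicalGroup G], Literature.AlgebraicGeometry.Frobenioids.NFLocCat.EConnected G D :=
  fun D _ => NFLocCat.eConnected_holds D

/-- FACT-LIST F-1168: [FrdII] Ex 1.4 (ii): ℰ is of FSMFF-type; exact-name CLOSED witness (proof = `NFLocCat.eFSMFF_holds`,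
NumberFieldLocalizationCategoriesFSMFF.lean). [cite: MochizukiFrdII2008, Example 1.4 (ii) p.13] -/
theorem NFLocCat.EFSMFF_holds :
    ∀ {G : Type u} [Group G] [TopologicalSpace G] [IsTopologicalGroup G] (D : Subgroup G), Literature.AlgebraicGeometry.Frobenioids.NFLocCat.EFSMFF G D :=
  fun D => NFLocCat.eFSMFF_holds D

/-- FACT-LIST F-1169: [FrdII] Ex 1.4 (ii): ℰ is totally epimorphic; exact-name CLOSED witness (proof = `NFLocCat.eTotallyEpimorphic_holds`,
NumberFieldLocalizationCategoriesProofs.lean). [cite: MochizukiFrdII2008, Example 1.4 (ii) p.13] -/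
theorem NFLocCat.ETotallyEpimorphic_holds :
    ∀ {G : Type u} [Group G] [TopologicalSpace G] (D : Subgroup G) [IsTopologicalGroup G], Literature.AlgebraicGeometry.Frobenioids.NFLocCat.ETotallyEpimorphic G D :=
  fun D _ => NFLocCat.eTotallyEpimorphic_holds D

/-- FACT-LIST F-1170: [FrdII] Ex 1.4 (ii): description of the FSM morphisms of ℰ; exact-name CLOSED witness (proof = `NFLocCat.fsmDescription_holds`,
NumberFieldLocalizationCategoriesProofs.lean). [cite: MochizukiFrdII2008, Example 1.4 (ii) p.13] -/
theorem NFLocCat.FSMDescription_holds :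
    ∀ {G : Type u} [Group G] [TopologicalSpace G] (D : Subgroup G) [IsTopologicalGroup G], Literature.AlgebraicGeometry.Frobenioids.NFLocCat.FSMDescription G D :=
  fun D _ => NFLocCat.fsmDescription_holds D

/-- FACT-LIST F-1171: [FrdII] Ex 1.4 (ii): ℰ is not of FSM-type; exact-name CLOSED witness (proof = `NFLocCat.notFSMType_holds`,
NumberFieldLocalizationCategoriesProofs.lean). [cite: MochizukiFrdII2008, Example 1.4 (ii) p.13] -/
theorem NFLocCat.NotFSMType_holds :
    ∀ {G : Type u} [Group G] [TopologicalSpace G] (D : Subgroup G) [IsTopologicalGroup G], Literature.AlgebraicGeometry.Frobenioids.NFLocCat.NotFSMType G D :=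
  fun D _ => NFLocCat.notFSMType_holds D

/-- FACT-LIST F-1172: [FrdII] Ex 1.4 (ii): for profinite G, ℰ → 𝒫₀ is arrow-wise essentially surjective; exact-name CLOSED witness (proof = `NFLocCat.toP₀ArrowwiseEssSurj_holds`,
NumberFieldLocalizationCategoriesFSMFF.lean). [cite: MochizukiFrdII2008, Example 1.4 (ii) p.13] -/
theorem NFLocCat.ToP₀ArrowwiseEssSurj_holds :
    ∀ {G : Type u} [Group G] [TopologicalSpace G] [IsTopologicalGroup G] (D : Subgroup G) [CompactSpace G] [TotallyDisconnectedSpace G], Literature.AlgebraicGeometry.Frobenioids.NFLocCat.ToP₀ArrowwiseEssSurj G D :=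
  fun D _ _ => NFLocCat.toP₀ArrowwiseEssSurj_holds D

/-- FACT-LIST F-1173: [FrdII] Ex 1.4 (ii): ℰ → 𝒫₀ is faithful; exact-name CLOSED witness (proof = `NFLocCat.toP₀Faithful_holds`,
NumberFieldLocalizationCategoriesProofs.lean). [cite: MochizukiFrdII2008, Example 1.4 (ii) p.13] -/
theorem NFLocCat.ToP₀Faithful_holds :
    ∀ {G : Type u} [Group G] [TopologicalSpace G] (D : Subgroup G) [IsTopologicalGroup G], Literature.AlgebraicGeometry.Frobenioids.NFLocCat.ToP₀Faithful G D :=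
  fun D _ => NFLocCat.toP₀Faithful_holds D

/-- FACT-LIST F-1175: [FrdII] Prop 1.5 (ix) input: 𝒫 has trivial factorizations; exact-name CLOSED witness (proof = `NFLocCat.pHasTrivialFactorizations_holds`,
NumberFieldLocalizationApplication.lean). [cite: MochizukiFrdII2008, Proposition 1.5 (ix) p.15] -/
theorem NFLocCat.PHasTrivialFactorizations_holds :
    ∀ (G : Type u) [Group G] [TopologicalSpace G] [IsTopologicalGroup G] (D : Subgroup G), Literature.AlgebraicGeometry.Frobenioids.NFLocCat.PHasTrivialFactorizations G D :=
  fun G _ _ _ D => NFLocCat.pHasTrivialFactorizations_holds G D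

/-- FACT-LIST F-1177: [FrdII] Prop 1.5 (i) input: hom-reconstruction for ℰ → 𝒫₀; exact-name CLOSED witness (proof = `NFLocCat.toP₀HomReconstruction_holds`,
NumberFieldLocalizationApplication.lean). [cite: MochizukiFrdII2008, Proposition 1.5 (i) p.15] -/
theorem NFLocCat.ToP₀HomReconstruction_holds :
    ∀ (G : Type u) [Group G] [TopologicalSpace G] [IsTopologicalGroup G] (D : Subgroup G), Literature.AlgebraicGeometry.Frobenioids.NFLocCat.ToP₀HomReconstruction G D :=
  fun G _ _ _ D => NFLocCat.toP₀HomReconstruction_holds G D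

end Literature.AlgebraicGeometry.Frobenioids
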